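import Literature.AlgebraicGeometry.Motives.HodgeRealSplittingGluedBlocks
import Literature.AlgebraicGeometry.HodgeTheory.TotallyRealMaxSubfieldPowersHodgeClasses
import Literature.AlgebraicGeometry.HodgeTheory.NoTypeIVTimesCMProductSpan
import Literature.AlgebraicGeometry.Motives.AbelianVarietyEndAlgebraInstances
import HarnessLib

/-!
# Hodge classes on all powers of a simple complex abelian variety of type II with minimal dimension are generated by divisor classes — from a REAL SPLITTING `End⁰(A) ⊗ ℝ ≅ ∏ M₂(ℝ)` alone, WITHOUT a maximal subfield (Moonen–Zarhin 1999 (2.2) Type 2(1); Banaszak–Gajda–Krasoń 2006 (7.22), Thm. 7.34 for `h = 1`; V. K. Murty 1988 Thm. 2, `m = 1`), PROVED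

Family `hodge`, layer `Literature/AlgebraicGeometry/HodgeTheory`. Research context: cell `pub-hodge-ring2`
(HONEST FRAMING: research route conditional on HC_CM; not a corollary; Q11.4-sentence-2 already refuted in
dim ≥ 3), Literature lane, programme R7 «type II minimal without a maximal subfield». UNCONDITIONAL and
FACT-FREE: theorems only, no definition, no named fact (D-0026); the tree-light Betti hypotheses `hHD`, `hI`
and the instance `HodgeTensorFacts` are discharged by the tree theorems `exists_isReal_hodgeModel_holds`,
`hodgePQ_independent_of_hodgeModel_holds`, `hodgeTensorFacts_holds`; no step towards a summit statement
(published theorems: Murty 1988 Thm. 2, Banaszak–Gajda–Krasoń 2006 Thm. 7.34).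

PUBLISHED STATEMENTS. Banaszak–Gajda–Krasoń, Doc. Math. Extra Vol. Coates (2006) 35–75: p. 36 «type II:
`D ⊗_ℚ ℝ = ∏ M_{2,2}(ℝ)`»; Definition of class 𝒜 (p. 60): `A` simple of type I or II with `g = h e d`, `h`
odd (`e = [E:ℚ]`, `E` the centre, `d² = [D:E]`); Cor. 7.19 (7.22) (p. 67) «`H(A) = L(A) = C_D(Sp(V, ψ))`»;
Thm. 7.34 (p. 69) «The Hodge conjecture holds true for abelian varieties of class 𝒜» (by [Mu] = Murty 1984
Thm. 3.1). Moonen–Zarhin, Math. Ann. 315 (1999), (2.2) «Type 2(1): `D = End⁰(X)` a quaternion algebra over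
`ℚ` split at `∞` … `Hg(X) = U_{D^opp}`», (1.8) `V_ℂ = W ⊗ ℂ²`. V. K. Murty, Proc. AMS 104 (1988), Thm. 2
(p. 67): «`V` free over `E` of rank `2m`, `m` odd ⟹ `Hod(A) = L(A)`, `𝓑(Aᵏ) = 𝓓(Aᵏ)` for all `k ≥ 1`».
THIS FILE proves the case `h = 1` of type II (`d = 2`): `dim A = 2e`, in the rendering

  `A` SIMPLE, `Φ : ℝ ⊗_ℚ End⁰(A) ≃ₐ[ℝ] (ι → M₂(ℝ))`, `dim A = 2 · |ι|`
  `⟹ B•(A^{N+1}) = D•(A^{N+1}) ⊗ ℂ` and the Hodge conjecture for every `A^{N+1}` and everything isogenous.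

It SUPERSEDES the tree's `hodgeConjectureFor_powSucc_of_isMurtyTypeWith_one` (programme R6, file
`TotallyRealMaxSubfieldPowersHodgeClasses`) on the type II minimal locus: no totally real maximal subfield
`K ⊂ End⁰(A)`, no embedding `φ`, no self-commutant verification is needed — all abelian surfaces with
quaternionic multiplication (Moonen–Zarhin's Type 2(1)), the type II(2) fourfolds and the atlas row II(3) of
`Summits/HodgeConjecture/HodgeConjecture/Theorems/Ring2AtlasTypeIIRows` are covered by ONE hypothesis, the
real splitting. (A passage from the tree's `IsTotallyIndefinite` — splitting at the completions — to an
explicit `Φ` is NOT provided here.)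

SETTING AND PROOF. `H = H¹(A(ℂ); ℚ)` with its Hodge structure, `θ = bettiRep A : End⁰(A) → (End_ℚ H)ᵐᵒᵖ`
the (injective) rational representation, whose image is EXACTLY `End_Hdg(H)` (Riemann:
`mem_endAlg_hodge_one_iff_exists_bettiRep`); `End⁰(A)` is a division ring (`A` simple, Mumford §19 Cor. 2)
of `ℚ`-dimension `4|ι| = 2 dim A = dim_ℚ H`. The abstract theorem
`HodgeStructure.RealSplitting.exists_glued_adapted_blockBasis` (`Motives/HodgeRealSplittingGluedBlocks`)
then cuts `H ⊗ ℂ` into the `2|ι|` two-dimensional REAL blocks `W_{(i,j)} = u(i)_{jj} · H_ℂ` of the real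
matrix units of `Φ` and provides a class map `cls` and GLUED HODGE-ADAPTED bases `b'` such that every
admissible rational Lie algebra (bracket-closed, `ψ`-skew, commuting with `End_Hdg`, containing the Hodge
operator) is `⊕_{classes} 𝔰𝔩₂(ℂ)` acting diagonally (§1 `exists_glued_adapted_blockBasis_of_realSplitting`,
and the `iff` form `exists_mem_hodgeLieC_iff_of_realSplitting`: `Lie Hg(A) ⊗ ℂ = ⊕_{classes} 𝔰𝔩₂(ℂ)` — the
Lie algebra of Moonen–Zarhin's `U_{D^opp}` / B–G–K's `C_D(Sp(V, ψ))`). §2 is the ASSEMBLY, verbatim the one of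
`AVSlots.gluedHodgeClasses_divisorial` (programme R6) with the eigenline blocks of a maximal subfield replaced
by the matrix-unit blocks: the invariance theorem `AVSlots.exists_gluedInvariant_coeff`, the degree-two
theorems `theta_mem_span_rational_oneOne_of_glued` / `intertwiner_one_mem_span_endAlg` and the classwise
first fundamental theorem `wordEval_gluedLetters_mem_divisorClassesSpan_of_classwise`. §3: the consequences
for `A^{N+1}`, `A`, isogenous varieties, and the abelian-SURFACE spelling `…_of_surface_realSplitting`
(`ℝ ⊗ End⁰(A) ≅ M₂(ℝ)`, `ι = Fin 1`: Moonen–Zarhin's Type 2(1) and all its powers); §4: the cell's PRODUCT ROWS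
`A^{N+1} × C`, `C` of CM type — `HC(A^{N+1} × C) ↔ HC(C)` (Lombardo 2016 Lemma 3.4 / Moonen–Zarhin (3.1), the
tree's discharged `Lombardo2016_hodgeClassesProductSpan_holds`, with §0's «no type IV») and `HC_CM ⟹ HC(A^{N+1} × C)`
— here, and only here, the research route's hypothesis HC_CM enters, as an explicit binder; §0: a real splitting forces «no factor of type IV»
(`hasNoTypeIVFactor_of_realSplitting`, Albert; no simplicity needed).

## References

* [BanaszakGajdaKrason2006] G. Banaszak, W. Gajda, P. Krasoń, *On the image of l-adic Galois representations
  for abelian varieties of type I and II*, Doc. Math. Extra Vol. Coates (2006) 35–75 (held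
  `paper:doi-10-4171-dms-4-2`): p. 36 (type II), Definition of class 𝒜 (p. 60), Cor. 7.19 (7.22) (p. 67),
  Thm. 7.34 (p. 69). [cite: BanaszakGajdaKrason2006, p. 36, (7.22) and Thm. 7.34]
* [MoonenZarhin1999LowDim] B. Moonen, Yu. Zarhin, *Hodge classes on abelian varieties of low dimension*,
  Math. Ann. 315 (1999) 711–733 (arXiv:math/9901113), (1.8), (2.2) Type 2(1), §3 (3.1).
  [cite: MoonenZarhin1999LowDim, (2.2) and (1.8)]
* [Murty1988] V. Kumar Murty, *The Hodge group of an abelian variety*, Proc. AMS 104 (1988) 61–68, Thm. 2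
  (p. 67) and §1 Remark 1. [cite: Murty1988, Thm. 2 (p. 67)]
* [Hazama1983] F. Hazama, Tôhoku Math. J. 35 (1983) 303–308, §3 (pp. 305–306). [cite: Hazama1983, §3 (pp. 305–306)]
* [Abdulali2016TateTwists] S. Abdulali, in: Kerr–Pearlstein (eds.), *Recent Advances in Hodge Theory* (2016),
  §2.4 (type II: `V_ℝ = ⊕ W_σ ⊗ ℝ²`). [cite: Abdulali2016TateTwists, §2.4]
* [MumfordAV1970] D. Mumford, *Abelian Varieties* (1970), §19 Cor. 2 of Thm. 1 (p. 174), §21 (Albert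
  classification, p. 201). [cite: MumfordAV1970, §19 Cor. 2 of Thm. 1 (p. 174)]
* [Lombardo2016] D. Lombardo, Ann. Inst. Fourier 66 (2016), Lemma 3.4 (p. 1229). [cite: Lombardo2016, Lemma 3.4 (p. 1229)]
* [vanGeemen1994HodgeAV] B. van Geemen, LNM 1594 (1994), Lemma 3.7. [cite: vanGeemen1994HodgeAV, Lemma 3.7]
* [Deligne2000] P. Deligne, The Hodge conjecture (Clay problem statement), §1. [cite: Deligne2000, §1]
-/

noncomputable section

open scoped TensorProduct
open CategoryTheory Module

namespace Literature.AlgebraicGeometry.HodgeTheory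

open Literature.AlgebraicTopology.SingularHomology
open Literature.AlgebraicGeometry.Motives (IsSmoothProjective AbelianVariety bettiCohomology
  HodgeTensorFacts hodgeTensorFacts_holds)
open Literature.Barriers.HodgeConjecture
open Literature.AlgebraicGeometry.Motives.HodgeStructure
open Literature.AlgebraicGeometry.ComplexMultiplication
open Literature.RepresentationTheory.GeneralLinear
open Literature.NumberTheory.DiophantineGeometry

variable {A B : AbelianVariety ℂ} {n : ℕ} {g : Fin n → (B ⟶ A)} {ι : Type} [Fintype ι] [DecidableEq ι]

/-! ### §0 A real splitting forces a totally real centre («no factor of type IV») and a division ring of the right size -/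

omit [DecidableEq ι] in
/-- **A real splitting `ℝ ⊗ End⁰(A) ≅ ∏ M₂(ℝ)` forces «no simple factor of type IV»**: every central
`z ∈ End⁰(A)` satisfies a non-zero rational polynomial all of whose complex roots are real (Cayley–Hamilton for
`z^*` on `H¹(A(ℂ); ℚ)`, whose complexification is a REAL combination of the diagonal matrix units; faithfulness
of the rational representation). Albert: the centre of a type II algebra is totally real. No simplicity is
needed. [cite: MumfordAV1970, §21 (p. 201)] [cite: BanaszakGajdaKrason2006, p. 36]
[cite: MoonenZarhin1999LowDim, §1] -/
theorem hasNoTypeIVFactor_of_realSplitting (Φ : ℝ ⊗[ℚ] A.endAlgebra ≃ₐ[ℝ] (ι → Matrix (Fin 2) (Fin 2) ℝ)) :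
    HasNoTypeIVFactor A := by
  classical
  intro z hz
  obtain ⟨f, hf0, hfz, hroots⟩ := RealSplitting.exists_aeval_eq_zero_of_mem_center (bettiRep A) Φ hz
  refine ⟨f, hf0, ?_, hroots⟩
  have h1 : bettiRep A (Polynomial.aeval z f) = 0 := by
    rw [← Polynomial.aeval_algHom_apply, ← MulOpposite.op_unop (bettiRep A z), Polynomial.aeval_op_apply, hfz,
      MulOpposite.op_zero]
  exact (injective_iff_map_eq_zero _).1 bettiRep_injective _ h1

/-- For a SIMPLE `A`, every non-zero element of `End⁰(A)` is a unit (Mumford §19 Cor. 2 of Thm. 1; the tree's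
`endAlgebra_exists_inv_of_isSimple`). [cite: MumfordAV1970, §19 Cor. 2 of Thm. 1 (p. 174)] -/
theorem isUnit_or_eq_zero_of_isSimple (hA : A.IsSimple) (z : A.endAlgebra) : IsUnit z ∨ z = 0 := by
  by_cases hz : z = 0
  · exact Or.inr hz
  · obtain ⟨y, hzy, hyz⟩ := endAlgebra_exists_inv_of_isSimple hA z hz
    exact Or.inl ⟨⟨z, y, hzy, hyz⟩, rfl⟩

omit [DecidableEq ι] in
/-- `dim_ℚ End⁰(A) = dim_ℚ H¹(A(ℂ); ℚ)` when `ℝ ⊗ End⁰(A) ≅ ∏_ι M₂(ℝ)` and `dim A = 2|ι|` (`4|ι| = 2 dim A`).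
[cite: BanaszakGajdaKrason2006, p. 36 and Definition of class 𝒜 (p. 60)] -/
theorem finrank_endAlgebra_eq_finrank_bettiCohomology_one_of_realSplitting
    (Φ : ℝ ⊗[ℚ] A.endAlgebra ≃ₐ[ℝ] (ι → Matrix (Fin 2) (Fin 2) ℝ)) (hdim : A.dim = 2 * Fintype.card ι) :
    Module.finrank ℚ A.endAlgebra = Module.finrank ℚ (bettiCohomology A.X 1) := by
  rw [RealSplitting.finrank_eq_four_mul_card Φ, finrank_bettiCohomology_one, hdim]
  ring

/-! ### §1 The glued Hodge-adapted block bases of the matrix-unit blocks of `H¹(A(ℂ); ℂ)` -/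

/-- **Theorem (the Lie algebra of the Hodge group of a type II minimal abelian variety is `⊕_{classes} 𝔰𝔩₂`,
glued, in the blocks of the real matrix units; Moonen–Zarhin 1999 (2.2) Type 2(1) / (1.8), BGK 2006 (7.22),
Murty 1988 Thm. 2 for `m = 1`).** For a simple `A` with a real splitting `Φ : ℝ ⊗ End⁰(A) ≃ ∏_ι M₂(ℝ)` and
`dim A = 2|ι|`, a polarization `ψ` of `H¹(A(ℂ); ℚ)` and a Hodge operator `Θ`, there are a class map `cls` on
`ι × Fin 2` and bases `b'_p = (b'_p 0 ∈ H^{1,0}, b'_p 1 ∈ H^{0,1})` of the blocks `W_p = u(i)_{jj} H¹_ℂ` such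
that for EVERY bracket-closed rational `ψ`-skew `𝔤 ⊆ End_ℚ(H¹)` commuting with `End_Hdg` with `Θ ∈ 𝔤_ℂ`:
trace-free blocks, equal blocks within a class, and every (class ⊗ trace-free `N`) in `𝔤_ℂ`. The abstract
`RealSplitting.exists_glued_adapted_blockBasis` at `θ = bettiRep A` (injective; image `= End_Hdg` by Riemann;
`End⁰(A)` a division ring of dimension `dim_ℚ H¹`). [cite: MoonenZarhin1999LowDim, (2.2) and (1.8)]
[cite: BanaszakGajdaKrason2006, (7.22)] [cite: Murty1988, Thm. 2 (p. 67)] [cite: Hazama1983, §3 (pp. 305–306)] -/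
theorem exists_glued_adapted_blockBasis_of_realSplitting [HodgeTensorFacts.{0, 0}] (hA : A.IsSimple)
    (Φ : ℝ ⊗[ℚ] A.endAlgebra ≃ₐ[ℝ] (ι → Matrix (Fin 2) (Fin 2) ℝ)) (hdim : A.dim = 2 * Fintype.card ι)
    (hHD : exists_isReal_hodgeModel) (hI : hodgePQ_independent_of_hodgeModel)
    (ψ : (BettiUniverse.hodge hHD (AbelianVariety.isSmoothProjective_holds (A := A)) 1).Polarization)
    {Θ : Module.End ℂ (ℂ ⊗[ℚ] bettiCohomology A.X 1)}
    (hΘ : ∀ p, ∀ x ∈ (BettiUniverse.hodge hHD (AbelianVariety.isSmoothProjective_holds (A := A)) 1).piece p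
      (((1 : ℕ) : ℤ) - p), Θ x = ((2 * p - ((1 : ℕ) : ℤ) : ℤ) : ℂ) • x) :
    ∃ (cls : ι × Fin 2 → ι × Fin 2)
      (b' : ∀ k : ι × Fin 2, Module.Basis (Fin 2) ℂ (RealSplitting.block (bettiRep A) Φ k)),
      (∀ k, (b' k 0 : ℂ ⊗[ℚ] bettiCohomology A.X 1) ∈
        (BettiUniverse.hodge hHD (AbelianVariety.isSmoothProjective_holds (A := A)) 1).piece 1 0) ∧
      (∀ k, (b' k 1 : ℂ ⊗[ℚ] bettiCohomology A.X 1) ∈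
        (BettiUniverse.hodge hHD (AbelianVariety.isSmoothProjective_holds (A := A)) 1).piece 0 1) ∧
      (∀ k, cls (cls k) = cls k) ∧
      ∀ 𝔤 : Submodule ℚ (Module.End ℚ (bettiCohomology A.X 1)),
        (∀ X ∈ 𝔤, ∀ Y ∈ 𝔤, X * Y - Y * X ∈ 𝔤) → Θ ∈ spanC 𝔤 →
        (∀ X ∈ 𝔤, ∀ a : (BettiUniverse.hodge hHD (AbelianVariety.isSmoothProjective_holds (A := A)) 1).endAlg,
          X * (a : Module.End ℚ (bettiCohomology A.X 1)) = (a : Module.End ℚ (bettiCohomology A.X 1)) * X) →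
        (∀ X ∈ 𝔤, ∀ v w, ψ.form (X v) w + ψ.form v (X w) = 0) →
        (∀ Y ∈ spanC 𝔤, ∀ k,
          (RealPlaces.blockMat (RealSplitting.isInternal_block (bettiRep A) Φ) b' Y k).trace = 0) ∧
        (∀ Y ∈ spanC 𝔤, ∀ k k', cls k = cls k' →
          RealPlaces.blockMat (RealSplitting.isInternal_block (bettiRep A) Φ) b' Y k =
            RealPlaces.blockMat (RealSplitting.isInternal_block (bettiRep A) Φ) b' Y k') ∧
        (∀ (k₀ : ι × Fin 2) (N : Matrix (Fin 2) (Fin 2) ℂ), N.trace = 0 →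
          RealPlaces.assemble (RealSplitting.isInternal_block (bettiRep A) Φ) b'
            (fun k => if cls k = cls k₀ then N else 0) ∈ spanC 𝔤) := by
  haveI : Module.Finite ℚ (bettiCohomology A.X 1) := finite_bettiCohomology_one A
  have hX : IsSmoothProjective A.dim A.X := AbelianVariety.isSmoothProjective_holds
  obtain ⟨cls, b', hb0, hb1, hidem, hall⟩ := RealSplitting.exists_glued_adapted_blockBasis (bettiRep A) Φ
    (BettiUniverse.hodge hHD (AbelianVariety.isSmoothProjective_holds (A := A)) 1) Nat.cast_one
    (BettiUniverse.hodge_isEffective hHD hX 1) ψ bettiRep_injective (unop_bettiRep_mem_endAlg hHD hI)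
    (fun a ha => (mem_endAlg_hodge_one_iff_exists_bettiRep hHD hI a).1 ha) (isUnit_or_eq_zero_of_isSimple hA)
    (finrank_endAlgebra_eq_finrank_bettiCohomology_one_of_realSplitting Φ hdim) hΘ
  refine ⟨cls, b', fun k => ?_, fun k => ?_, hidem, hall⟩
  · have h := hb0 k
    have e : (((1 : ℕ) : ℤ) - 1) = 0 := by norm_num
    rwa [e] at h
  · have h := hb1 k
    have e : (((1 : ℕ) : ℤ) - 0) = 1 := by norm_num
    rwa [e] at h

/-- A family constant on the classes is the sum over the classes of its class-indicator pieces. [folklore] -/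
private theorem eq_sum_classIndicator' {κ : Type*} [Fintype κ] [DecidableEq κ] {M : Type*} [AddCommMonoid M]
    (cls : κ → κ) (f : κ → M) (hf : ∀ k, f k = f (cls k)) :
    f = ∑ γ ∈ Finset.univ.image cls, fun k => if cls k = γ then f γ else 0 := by
  funext k
  rw [Finset.sum_apply, Finset.sum_eq_single (cls k)]
  · rw [if_pos rfl, ← hf]
  · intro γ _ hγ
    rw [if_neg (Ne.symm hγ)]
  · intro h
    exact absurd (Finset.mem_image_of_mem cls (Finset.mem_univ k)) h

/-- **Theorem (the Lie algebra of the Hodge group of a type II minimal abelian variety; Moonen–Zarhin 1999 (2.2)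
Type 2(1) «`Hg(X) = U_{D^opp}`», Banaszak–Gajda–Krasoń 2006 (7.22) «`H(A) = L(A) = C_D(Sp(V, ψ))`», Murty 1988
Thm. 2 «`Hod(A) = L(A)`» for `m = 1`), Lie-algebra form.** For a simple `A` with a real splitting
`Φ : ℝ ⊗ End⁰(A) ≃ ∏_ι M₂(ℝ)` and `dim A = 2|ι|` there are a class map `cls` and glued Hodge-adapted bases `b'` of
the matrix-unit blocks `W_p` in which a `ℂ`-linear endomorphism `Y` of `H¹ ⊗ ℂ` lies in `Lie Hg(A) ⊗ ℂ` IF AND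
ONLY IF it preserves every block, has trace-free blocks, and has EQUAL blocks on each class:
`Lie Hg(A) ⊗ ℂ = ⊕_{classes} 𝔰𝔩₂(ℂ)` (Abdulali §2.4: «a symplectic group acting as two copies of the standard
representation»). [cite: MoonenZarhin1999LowDim, (2.2) and (1.8)] [cite: BanaszakGajdaKrason2006, (7.22)]
[cite: Murty1988, Thm. 2 (p. 67)] [cite: Abdulali2016TateTwists, §2.4] -/
theorem exists_mem_hodgeLieC_iff_of_realSplitting [HodgeTensorFacts.{0, 0}] (hA : A.IsSimple)
    (Φ : ℝ ⊗[ℚ] A.endAlgebra ≃ₐ[ℝ] (ι → Matrix (Fin 2) (Fin 2) ℝ)) (hdim : A.dim = 2 * Fintype.card ι)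
    (hHD : exists_isReal_hodgeModel) (hI : hodgePQ_independent_of_hodgeModel) :
    ∃ (cls : ι × Fin 2 → ι × Fin 2)
      (b' : ∀ k : ι × Fin 2, Module.Basis (Fin 2) ℂ (RealSplitting.block (bettiRep A) Φ k)),
      (∀ k, (b' k 0 : ℂ ⊗[ℚ] bettiCohomology A.X 1) ∈
        (BettiUniverse.hodge hHD (AbelianVariety.isSmoothProjective_holds (A := A)) 1).piece 1 0) ∧
      (∀ k, (b' k 1 : ℂ ⊗[ℚ] bettiCohomology A.X 1) ∈
        (BettiUniverse.hodge hHD (AbelianVariety.isSmoothProjective_holds (A := A)) 1).piece 0 1) ∧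
      (∀ k, cls (cls k) = cls k) ∧
      ∀ Y : Module.End ℂ (ℂ ⊗[ℚ] bettiCohomology A.X 1),
        Y ∈ (BettiUniverse.hodge hHD (AbelianVariety.isSmoothProjective_holds (A := A)) 1).hodgeLieC ↔
          (∀ k, Set.MapsTo Y (RealSplitting.block (bettiRep A) Φ k) (RealSplitting.block (bettiRep A) Φ k)) ∧
          (∀ k, (RealPlaces.blockMat (RealSplitting.isInternal_block (bettiRep A) Φ) b' Y k).trace = 0) ∧
          (∀ k k', cls k = cls k' → RealPlaces.blockMat (RealSplitting.isInternal_block (bettiRep A) Φ) b' Y k =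
            RealPlaces.blockMat (RealSplitting.isInternal_block (bettiRep A) Φ) b' Y k') := by
  classical
  haveI : Module.Finite ℚ (bettiCohomology A.X 1) := finite_bettiCohomology_one A
  have hX : IsSmoothProjective A.dim A.X := AbelianVariety.isSmoothProjective_holds
  set H := BettiUniverse.hodge hHD (AbelianVariety.isSmoothProjective_holds (A := A)) 1 with hH
  -- a polarization and a Hodge operator
  obtain ⟨ψ⟩ : H.IsPolarizable :=
    smoothProjective_hodgeStructure_isPolarizable_holds hX (BettiUniverse.realHodgeModel hHD hX)
      (BettiUniverse.realHodgeModel_isHodgeSymmetric hHD hX) 1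
  obtain ⟨Θ, hΘ⟩ := exists_hodgeTheta H
  obtain ⟨cls, b', hb0, hb1, hidem, hall⟩ := exists_glued_adapted_blockBasis_of_realSplitting hA Φ hdim hHD hI ψ hΘ
  have hρ : ∀ z : A.endAlgebra, MulOpposite.unop (bettiRep A z) ∈ H.endAlg := unop_bettiRep_mem_endAlg hHD hI
  -- `Lie Hg` is admissible
  have hΘC : Θ ∈ spanC H.hodgeLie := H.mem_hodgeLieC_of_forall_piece hΘ
  obtain ⟨h1, h2, h3⟩ := hall H.hodgeLie (fun X hX Y hY => H.commutator_mem_hodgeLie hX hY) hΘC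
    (fun X hX a => H.commute_of_mem_hodgeLie hX a) (fun X hX v w => form_apply_add_eq_zero_of_mem_hodgeLie ψ hX v w)
  have hT : ∀ X ∈ H.hodgeLie, ∀ k, Set.MapsTo (X.baseChange ℂ) (RealSplitting.block (bettiRep A) Φ k)
      (RealSplitting.block (bettiRep A) Φ k) :=
    fun X hX k => RealSplitting.mapsTo_block_of_forall_commute (bettiRep A) Φ H hρ
      (fun a => H.commute_of_mem_hodgeLie hX a) k
  refine ⟨cls, b', hb0, hb1, hidem, fun Y => ⟨fun hY => ?_, fun hY => ?_⟩⟩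
  · have hY' : Y ∈ spanC H.hodgeLie := hY
    exact ⟨fun k => mapsTo_of_mem_spanC (T := RealSplitting.block (bettiRep A) Φ k) (fun X hX => hT X hX k) hY',
      h1 Y hY', h2 Y hY'⟩
  · obtain ⟨hYT, htr, hcls⟩ := hY
    -- `Y = assemble (blockMat Y)`, and `blockMat Y` is constant on the classes
    have hconst : ∀ k, RealPlaces.blockMat (RealSplitting.isInternal_block (bettiRep A) Φ) b' Y k =
        RealPlaces.blockMat (RealSplitting.isInternal_block (bettiRep A) Φ) b' Y (cls k) :=
      fun k => hcls k (cls k) (by rw [hidem])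
    rw [show Y = RealPlaces.assemble (RealSplitting.isInternal_block (bettiRep A) Φ) b'
        (RealPlaces.blockMat (RealSplitting.isInternal_block (bettiRep A) Φ) b' Y) from
      (RealPlaces.assemble_blockMat _ b' hYT).symm,
      eq_sum_classIndicator' cls _ hconst, map_sum]
    refine Submodule.sum_mem _ fun γ hγ => ?_
    obtain ⟨k₀, -, rfl⟩ := Finset.mem_image.1 hγ
    have h := h3 (cls k₀) (RealPlaces.blockMat (RealSplitting.isInternal_block (bettiRep A) Φ) b' Y (cls k₀)) (htr _)
    simp only [hidem] at h
    exact h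

/-! ### §2 The assembly: `B•(B') ⊆ D•(B') ⊗ ℂ` for every abelian variety `B'` with slots over `A` -/

/-- **`Bᵖ(B) ⊆ Dᵖ(B) ⊗ ℂ` for an abelian variety `B` with slots over a simple type II minimal `A`** (in
particular `B = Aⁿ`): every rational class of type `(p,p)` in `H²ᵖ(B(ℂ); ℂ)` is a `ℂ`-combination of products
of `p` rational `(1,1)`-classes. BGK 2006 (7.22) `H(A) = L(A)` and Thm. 7.34; Murty 1988 Thm. 2 (`m = 1`)
«`𝓑(Aᵏ) = 𝓓(Aᵏ)` for all `k ≥ 1`». Assembled exactly as `AVSlots.gluedHodgeClasses_divisorial`, from §1, the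
invariance theorem `AVSlots.exists_gluedInvariant_coeff`, the degree-two theorems of `GluedBlocksDivisorClasses`
and the classwise first fundamental theorem; `hHD`, `hI`, `HodgeTensorFacts` discharged.
[cite: BanaszakGajdaKrason2006, (7.22) and Thm. 7.34] [cite: Murty1988, Thm. 2 (p. 67)]
[cite: MoonenZarhin1999LowDim, (2.2) and §3 (3.1)] [cite: Hazama1983, §3 (pp. 305–306)] -/
theorem AVSlots.realSplittingHodgeClasses_divisorial (hg : AVSlots A B g) (hA : A.IsSimple)
    (Φ : ℝ ⊗[ℚ] A.endAlgebra ≃ₐ[ℝ] (ι → Matrix (Fin 2) (Fin 2) ℝ)) (hdim : A.dim = 2 * Fintype.card ι)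
    (p : ℕ) (c : complexBetti B.X (2 * p)) (hcQ : IsRationalClass c)
    (hc : IsOfHodgeType B.dim B.X (2 * p) p p c) :
    c ∈ divisorClassesSpan B.X B.dim p := by
  classical
  rcases Nat.eq_zero_or_pos p with rfl | hp
  · exact AbelianVariety.mem_divisorClassesSpan_zero B c
  have hHD : exists_isReal_hodgeModel := exists_isReal_hodgeModel_holds
  have hI : hodgePQ_independent_of_hodgeModel := hodgePQ_independent_of_hodgeModel_holds
  haveI : HodgeTensorFacts.{0, 0} := hodgeTensorFacts_holds.{0, 0}
  haveI : Module.Finite ℚ (bettiCohomology A.X 1) := finite_bettiCohomology_one A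
  have hX : IsSmoothProjective A.dim A.X := AbelianVariety.isSmoothProjective_holds
  set H := BettiUniverse.hodge hHD (AbelianVariety.isSmoothProjective_holds (A := A)) 1 with hH
  -- a polarization of `H¹(A(ℂ); ℚ)` and a Hodge operator
  obtain ⟨ψ⟩ : H.IsPolarizable :=
    smoothProjective_hodgeStructure_isPolarizable_holds hX (BettiUniverse.realHodgeModel hHD hX)
      (BettiUniverse.realHodgeModel_isHodgeSymmetric hHD hX) 1
  obtain ⟨Θ, hΘ⟩ := exists_hodgeTheta H
  -- glued Hodge-adapted block bases of the matrix-unit blocks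
  obtain ⟨cls, b', hb0, hb1, -, hall⟩ := exists_glued_adapted_blockBasis_of_realSplitting hA Φ hdim hHD hI ψ hΘ
  have hint : DirectSum.IsInternal (RealSplitting.block (bettiRep A) Φ) :=
    RealSplitting.isInternal_block (bettiRep A) Φ
  have hρ : ∀ z : A.endAlgebra, MulOpposite.unop (bettiRep A z) ∈ H.endAlg := unop_bettiRep_mem_endAlg hHD hI
  -- `Lie Hg(A)` is admissible: its glued form
  have hΘC : Θ ∈ spanC H.hodgeLie := H.mem_hodgeLieC_of_forall_piece hΘ
  obtain ⟨-, hglue, hreach⟩ := hall H.hodgeLie (fun X hX Y hY => H.commutator_mem_hodgeLie hX hY) hΘC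
    (fun X hX a => H.commute_of_mem_hodgeLie hX a) (fun X hX v w => form_apply_add_eq_zero_of_mem_hodgeLie ψ hX v w)
  have hT : ∀ X ∈ H.hodgeLie, ∀ k, Set.MapsTo (X.baseChange ℂ) (RealSplitting.block (bettiRep A) Φ k)
      (RealSplitting.block (bettiRep A) Φ k) :=
    fun X hX k => RealSplitting.mapsTo_block_of_forall_commute (bettiRep A) Φ H hρ
      (fun a => H.commute_of_mem_hodgeLie hX a) k
  have hglue' : ∀ X ∈ H.hodgeLie, ∀ k k', cls k = cls k' →
      RealPlaces.blockMat hint b' (X.baseChange ℂ) k = RealPlaces.blockMat hint b' (X.baseChange ℂ) k' :=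
    fun X hX k k' hkk' => hglue _ (baseChange_mem_spanC hX) k k' hkk'
  have hreach' : ∀ (k₀ : ι × Fin 2) (N : Matrix (Fin 2) (Fin 2) ℂ), N.trace = 0 →
      RealPlaces.assemble hint b' (fun k => if cls k = cls k₀ then N else 0) ∈ H.hodgeLieC :=
    fun k₀ N hN => hreach k₀ N hN
  -- degree two: `θ_k` and the elementary intertwiners
  have hθ := theta_mem_span_rational_oneOne_of_glued hHD hI ψ hint b' hb0 hb1 cls hT hreach' hglue'
  have hu : ∀ k₁ k₂, cls k₁ = cls k₂ → RealPlaces.intertwiner hint b' k₁ k₂ 1 ∈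
      Submodule.span ℂ ((fun a : Module.End ℚ (bettiCohomology A.X 1) => a.baseChange ℂ) ''
        (H.endAlg : Set (Module.End ℚ (bettiCohomology A.X 1)))) :=
    fun k₁ k₂ hk => intertwiner_one_mem_span_endAlg hHD hint b' cls hT hglue' hk
  -- the Lie step: a classwise `𝔰𝔩₂`-invariant coefficient function
  obtain ⟨a, hca, hkill⟩ := hg.exists_gluedInvariant_coeff hHD hI ψ hint b' hb0 hb1 cls hΘ
    (fun 𝔤 hbr hΘ𝔤 hcomm hskew => (hall 𝔤 hbr hΘ𝔤 hcomm hskew).2.2) hp hcQ hc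
  rw [← hca]
  -- the cycle step: the classwise first fundamental theorem
  exact wordEval_gluedLetters_mem_divisorClassesSpan_of_classwise g hHD hI hint b' hθ cls hu
    (fun U col => hkill U col _ (by simp)) (fun U col => hkill U col _ (by simp))

/-- **`IsDivisorGenerated B`** for every abelian variety `B` with slots over a simple type II minimal `A` (the
tree's spelling of `B•(B) = D•(B) ⊗ ℂ`). [cite: BanaszakGajdaKrason2006, Thm. 7.34] [cite: Murty1988, Thm. 2 (p. 67)] -/
theorem AVSlots.isDivisorGenerated_of_isSimple_realSplitting (hg : AVSlots A B g) (hA : A.IsSimple)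
    (Φ : ℝ ⊗[ℚ] A.endAlgebra ≃ₐ[ℝ] (ι → Matrix (Fin 2) (Fin 2) ℝ)) (hdim : A.dim = 2 * Fintype.card ι) :
    IsDivisorGenerated B :=
  fun p c hcQ hc => hg.realSplittingHodgeClasses_divisorial hA Φ hdim p c hcQ hc

/-! ### §3 The powers of `A`: `B•(A^{N+1}) = D•(A^{N+1}) ⊗ ℂ` and the Hodge conjecture -/

variable (A) in
/-- **Type II minimal, all powers, PROVED: `B•(A^{N+1}) = D•(A^{N+1}) ⊗ ℂ`** for a simple complex abelian
variety `A` with a real splitting `ℝ ⊗ End⁰(A) ≅ ∏_ι M₂(ℝ)` and `dim A = 2|ι|` (Banaszak–Gajda–Krasoń's class 𝒜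
of type II with `h = 1`; Moonen–Zarhin Type 2(1) for surfaces; Murty Thm. 2 with `m = 1`). Compared with the
tree's `AbelianVariety.isDivisorGenerated_powSucc_of_isMurtyTypeWith_one`: no maximal subfield is needed.
[cite: BanaszakGajdaKrason2006, (7.22) and Thm. 7.34] [cite: Murty1988, Thm. 2 (p. 67)]
[cite: MoonenZarhin1999LowDim, (2.2)] -/
theorem AbelianVariety.isDivisorGenerated_powSucc_of_isSimple_realSplitting (hA : A.IsSimple)
    (Φ : ℝ ⊗[ℚ] A.endAlgebra ≃ₐ[ℝ] (ι → Matrix (Fin 2) (Fin 2) ℝ)) (hdim : A.dim = 2 * Fintype.card ι) (N : ℕ) :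
    IsDivisorGenerated (A.powSucc N) :=
  (AVSlots.powSucc A N).isDivisorGenerated_of_isSimple_realSplitting hA Φ hdim

variable (A) in
/-- `A` itself: `B•(A) = D•(A) ⊗ ℂ`. [cite: BanaszakGajdaKrason2006, Thm. 7.34] [cite: MoonenZarhin1999LowDim, (2.2)] -/
theorem AbelianVariety.isDivisorGenerated_of_isSimple_realSplitting (hA : A.IsSimple)
    (Φ : ℝ ⊗[ℚ] A.endAlgebra ≃ₐ[ℝ] (ι → Matrix (Fin 2) (Fin 2) ℝ)) (hdim : A.dim = 2 * Fintype.card ι) :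
    IsDivisorGenerated A :=
  (avSlots_self A).isDivisorGenerated_of_isSimple_realSplitting hA Φ hdim

/-- **The Hodge conjecture for all powers `A^{N+1}` of a simple complex abelian variety of type II with minimal
dimension — UNCONDITIONAL, from the real splitting alone** (`B = D` just proved, and `D ⊗ ℂ ⊆` algebraic classes
by the tree's `hodgeConjectureFor_of_isDivisorGenerated`; Murty's Remark 1). [cite: BanaszakGajdaKrason2006, Thm. 7.34]
[cite: Murty1988, Thm. 2 and §1 Remark 1] [cite: vanGeemen1994HodgeAV, §2.4] [cite: Deligne2000, §1] -/
theorem hodgeConjectureFor_powSucc_of_isSimple_realSplitting (hA : A.IsSimple)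
    (Φ : ℝ ⊗[ℚ] A.endAlgebra ≃ₐ[ℝ] (ι → Matrix (Fin 2) (Fin 2) ℝ)) (hdim : A.dim = 2 * Fintype.card ι) (N : ℕ) :
    HodgeConjectureFor (A.powSucc N).dim (A.powSucc N).X :=
  hodgeConjectureFor_of_isDivisorGenerated _
    (AbelianVariety.isDivisorGenerated_powSucc_of_isSimple_realSplitting A hA Φ hdim N)

/-- **Instance `N = 0`: the Hodge conjecture for `A` itself**, unconditional. [cite: BanaszakGajdaKrason2006, Thm. 7.34]
[cite: MoonenZarhin1999LowDim, (2.2)] -/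
theorem hodgeConjectureFor_self_of_isSimple_realSplitting (hA : A.IsSimple)
    (Φ : ℝ ⊗[ℚ] A.endAlgebra ≃ₐ[ℝ] (ι → Matrix (Fin 2) (Fin 2) ℝ)) (hdim : A.dim = 2 * Fintype.card ι) :
    HodgeConjectureFor A.dim A.X :=
  hodgeConjectureFor_powSucc_of_isSimple_realSplitting hA Φ hdim 0

/-- **The Hodge conjecture for every complex abelian variety isogenous to such a power** (van Geemen Lemma 3.7 =
the tree's `HodgeConjectureFor.of_isIsogenous`). [cite: vanGeemen1994HodgeAV, Lemma 3.7]
[cite: BanaszakGajdaKrason2006, Thm. 7.34] -/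
theorem hodgeConjectureFor_of_isIsogenous_powSucc_of_isSimple_realSplitting {B' : AbelianVariety ℂ}
    (hA : A.IsSimple) (Φ : ℝ ⊗[ℚ] A.endAlgebra ≃ₐ[ℝ] (ι → Matrix (Fin 2) (Fin 2) ℝ))
    (hdim : A.dim = 2 * Fintype.card ι) {N : ℕ} (hB : B'.IsIsogenous (A.powSucc N)) :
    HodgeConjectureFor B'.dim B'.X :=
  HodgeConjectureFor.of_isIsogenous hB (hodgeConjectureFor_powSucc_of_isSimple_realSplitting hA Φ hdim N)

/-- **Abelian surfaces with quaternionic multiplication (Moonen–Zarhin's Type 2(1): `End⁰(A)` a quaternion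
algebra over `ℚ` split at `∞`) and ALL THEIR POWERS: `B•(A^{N+1}) = D•(A^{N+1}) ⊗ ℂ`**, from a real splitting
`ℝ ⊗ End⁰(A) ≅ M₂(ℝ)` of a simple abelian surface (`ι = Fin 1`). [cite: MoonenZarhin1999LowDim, (2.2) and (1.8)]
[cite: BanaszakGajdaKrason2006, Thm. 7.34] -/
theorem AbelianVariety.isDivisorGenerated_powSucc_of_surface_realSplitting (hA : A.IsSimple)
    (Φ₁ : ℝ ⊗[ℚ] A.endAlgebra ≃ₐ[ℝ] Matrix (Fin 2) (Fin 2) ℝ) (hdim : A.dim = 2) (N : ℕ) :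
    IsDivisorGenerated (A.powSucc N) :=
  AbelianVariety.isDivisorGenerated_powSucc_of_isSimple_realSplitting A hA
    (Φ₁.trans (AlgEquiv.funUnique ℝ (Fin 1) (Matrix (Fin 2) (Fin 2) ℝ)).symm)
    (by rw [Fintype.card_fin, mul_one]; exact hdim) N

/-- **The Hodge conjecture for all powers of an abelian surface with quaternionic multiplication** (Moonen–Zarhin
Type 2(1)), unconditional, from a real splitting `ℝ ⊗ End⁰(A) ≅ M₂(ℝ)`. [cite: MoonenZarhin1999LowDim, (2.2) and (1.8)]
[cite: BanaszakGajdaKrason2006, Thm. 7.34] [cite: Deligne2000, §1] -/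
theorem hodgeConjectureFor_powSucc_of_surface_realSplitting (hA : A.IsSimple)
    (Φ₁ : ℝ ⊗[ℚ] A.endAlgebra ≃ₐ[ℝ] Matrix (Fin 2) (Fin 2) ℝ) (hdim : A.dim = 2) (N : ℕ) :
    HodgeConjectureFor (A.powSucc N).dim (A.powSucc N).X :=
  hodgeConjectureFor_of_isDivisorGenerated _
    (AbelianVariety.isDivisorGenerated_powSucc_of_surface_realSplitting hA Φ₁ hdim N)

/-! ### §4 Products with CM abelian varieties — the cell's rows; HC_CM enters only here, as an explicit binder -/

/-- **`HC(A^{N+1} × C) ⟺ HC(C)`** for a simple type II minimal `A` (real splitting, `dim A = 2|ι|`) and `C` of CM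
type: the product-span theorem for «no type IV» × CM (Lombardo 2016 Lemma 3.4, Moonen–Zarhin (3.1); the tree's
`hodgeConjectureFor_prod_iff_of_hasNoTypeIVFactor_of_isOfCMType`, whose span fact is DISCHARGED) with §0's
`hasNoTypeIVFactor_of_realSplitting` and §3's unconditional `HC(A^{N+1})`. [cite: Lombardo2016, Lemma 3.4 (p. 1229)]
[cite: MoonenZarhin1999LowDim, §3 (3.1)] [cite: BanaszakGajdaKrason2006, Thm. 7.34] -/
theorem hodgeConjectureFor_powSucc_prod_iff_of_isSimple_realSplitting_of_isOfCMType (hA : A.IsSimple)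
    (Φ : ℝ ⊗[ℚ] A.endAlgebra ≃ₐ[ℝ] (ι → Matrix (Fin 2) (Fin 2) ℝ)) (hdim : A.dim = 2 * Fintype.card ι) (N : ℕ)
    {C : AbelianVariety ℂ} (hCt : Milne1999.IsOfCMType C) :
    HodgeConjectureFor ((A.powSucc N).prod C).dim ((A.powSucc N).prod C).X ↔ HodgeConjectureFor C.dim C.X := by
  rw [hodgeConjectureFor_prod_iff_of_hasNoTypeIVFactor_of_isOfCMType (A.powSucc N) C
    ((hasNoTypeIVFactor_of_realSplitting Φ).powSucc N) hCt]
  exact ⟨fun h => h.2, fun h => ⟨hodgeConjectureFor_powSucc_of_isSimple_realSplitting hA Φ hdim N, h⟩⟩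

/-- **HC_CM ⟹ HC(`A^{N+1} × C`)** for a simple type II minimal `A` and `C` of CM type — the research route's row,
CONDITIONAL ON HC_CM (the binder `hCM`; not a corollary of anything unconditional here).
[cite: Lombardo2016, Lemma 3.4 (p. 1229)] [cite: MoonenZarhin1999LowDim, §3 (3.1)] [cite: Deligne2000, §1] -/
theorem hodgeConjectureFor_powSucc_prod_of_isSimple_realSplitting_of_cmHodgeHypothesis
    (hCM : ∀ Y : AbelianVariety ℂ, Milne1999.CMHodgeHypothesisAt Y) (hA : A.IsSimple)
    (Φ : ℝ ⊗[ℚ] A.endAlgebra ≃ₐ[ℝ] (ι → Matrix (Fin 2) (Fin 2) ℝ)) (hdim : A.dim = 2 * Fintype.card ι) (N : ℕ)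
    {C : AbelianVariety ℂ} (hCt : Milne1999.IsOfCMType C) :
    HodgeConjectureFor ((A.powSucc N).prod C).dim ((A.powSucc N).prod C).X :=
  hodgeConjectureFor_powSucc_prod_of_hasNoTypeIVFactor_of_cmHodgeHypothesis hCM A C
    (hasNoTypeIVFactor_of_realSplitting Φ) hCt N (hodgeConjectureFor_powSucc_of_isSimple_realSplitting hA Φ hdim N)

end Literature.AlgebraicGeometry.HodgeTheory

end
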